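import Literature.MathematicalPhysics.QuantumFieldTheory.Balaban1983to89.B4Prop31Prism
import Literature.MathematicalPhysics.QuantumFieldTheory.Balaban1983to89.B4Prop31Charts

/-!
# `Balaban1983to89.B4Prop31Averaging` — T. Bałaban, *Regularity and decay of lattice Green's functions*, Commun.
Math. Phys. **89** (1983) 571–597 [Balaban1983RegularityDecay] (= [B4]): «Proposition 3.1′ of [2]» (1.21)–(1.22)
p. 574 at `A ≠ 0` — file 3b/3: THE COVARIANT AVERAGING INEQUALITY on a union of unit blocks

statement-level skeleton of published theorems with citation tags; proofs where landed; nothing here is a claim about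
the Yang–Mills mass gap

PDF held: `paper:balaban1983-cmp89-regularity-decay` (journal page = PDF page + 570); pp. 572–574 [PDF 2–4], 589–591
[PDF 19–21] read.

CITATION HEADER (lean-in-tree rule).  Phase-2 PROOF file of the lit-balaban typed skeleton (HOME
`run/shared/lean/pub/lit-balaban/`), SKELETON row **`B4.Prop3.1'[II]`** (owner r01, referee ref-4), seat p35 gen 2 (unit
`lit-balaban-p35`); companions `B4Prop31Energy` (file 1: the variational representation (4.1)–(4.3) of
`Δ^{(k)}(Ω,A)`), `B4Prop31Prism` (2a: abelian prism inequality), `B4Prop31Holonomy` (2b: contour sums, holonomy bound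
from (1.21)), `B4Prop31Charts` (3a: carriers, block charts, bond counting), `B4Prop31Regular` (3c: (1.22) and the
typed leaf `B4.Prop31Printed` on the regular-region family).

THE PRINTED TEXT it serves (p. 574 [PDF 4], (1.22)): *"⟨φ, Δ^{(k)}(Ω,A)φ⟩ ≥ γ₀(Σ_{⟨x,x′⟩⊂Ω^{(k)}}|U(A(⟨x,x′⟩))φ(x′)
− φ(x)|² + m²Σ_{x∈Ω^{(k)}}|φ(x)|²) − O(1)e^{2−α}Σ_{x∈Ω^{(k)}}|φ(x)|²"* and the mechanism of its bond part, p. 590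
[PDF 20] (4.7)–(4.10): the unit-lattice covariant difference `U(A(⟨x,x′⟩))φ(x′) − φ(x)` is compared with the block
averages `Q_k(A)φ′` through the contours `Γ^{(k)}_{y,z}`, `z ∈ B^k(y)`, the error being `O(1)e²p²(e)` by the
regularity (1.21).  DICTIONARY (lattice units, as `B4Prop31Charts`): `η = 1/n`, `s = η^{d+1} = n^{-(d+1)}`,
`Q_k(A) = s·Q` with `Q = avgOp (rBlkWt) (transR)` the transported block SUMS along [B4]'s staircase contours.

WHAT IS KERNEL-CHECKED (zero `sorry`, standard axioms; no new `Prop`-valued statement).  For ANY link coupling `κ`,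
ANY vector field `A_ν(x)` in component form, ANY finite `Ωc`, any fine field `Φ` and unit-lattice field `ψ`, and any
`ρ` bounding the prism holonomies `|κΛ(y,μ,x)| ≤ ρ` (`B4Prop31Holonomy.loopSum`; `ρ = (3d+4)·O(1)·e·p(e)` under
(1.21) by `abs_loopSum_le`), for a flow with `|(U(t) − 1)v|² ≤ (ℓt)²|v|²`:
**`covDiffSq_le`**: `Σ_{⟨y,y′⟩⊂Ω^{(k)}}|U(A(⟨y,y′⟩))ψ(y′) − ψ(y)|² ≤ 6(d+1)·|ψ − sQΦ|² + 6(d+1)(ℓρ)²·s|Φ|² +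
24·s·⟨Φ, (−Δ_A)Φ⟩` — via the prism inequality per chart point (`chart_prism_le`), Cauchy–Schwarz over the block
(`nsq_smul_sum_le`), the per-bond estimate (`bond_term_le`), the counting facts of `B4Prop31Charts`, and
`bond_sum_le_covLap` (the positively oriented bonds are among those of (1.3)).  The constants `6(d+1)`, `24` are the
lineage's (the paper's `γ₀′`, `O(1)` are unspecified).
Unit `lit-balaban-p35` (gen 2), HOME as above.
-/

namespace Literature.MathematicalPhysics.QuantumFieldTheory.Balaban1983to89.B4Prop31Averaging

open Matrix Finset
open Literature.MathematicalPhysics.QuantumFieldTheory.Balaban1983to89.B4GaugeCovariance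
open Literature.MathematicalPhysics.QuantumFieldTheory.Balaban1983to89.B4Lower18Regular
  (dotProduct_self_nonneg' orth_dotProduct_mulVec_self sum_smul_dotProduct_self_le dotProduct_eq_sum_fld
    e1 e1_apply_self e1_apply_ne)
open Literature.MathematicalPhysics.QuantumFieldTheory.Balaban1983to89.B4Lower18RegularRegion
  (regWt regWt_nonneg rBlkWt rbaseEmb rstairContour compField compField_add e1_inj)
open Literature.MathematicalPhysics.QuantumFieldTheory.Balaban1983to89.B4Reflection242 (nbrs blk mem_nbrs)
open Literature.MathematicalPhysics.QuantumFieldTheory.Balaban1983to89.B4Lower18 (fineDom mem_fineDom)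
open Literature.MathematicalPhysics.QuantumFieldTheory.Balaban1983to89.B4BoxCov237
  (finePt_apply blk_finePt finePt_injective)
open Literature.MathematicalPhysics.QuantumFieldTheory.Balaban1983to89.B4Prop31Prism (prism_sq_le)
open Literature.MathematicalPhysics.QuantumFieldTheory.Balaban1983to89.B4Prop31Holonomy
open Literature.MathematicalPhysics.QuantumFieldTheory.Balaban1983to89.B4Prop31Charts

open B4Green244 (finePt)

noncomputable section

variable {ι : Type*} [Fintype ι] [DecidableEq ι] {d : ℕ}

/-! ## §1  Elementary inequalities and the bonds of (1.3) -/

omit [DecidableEq ι] in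
/-- `|A + B − C|² ≤ 3|A|² + 3|B|² + 3|C|²`. [cite: Balaban1983RegularityDecay, p. 590 (4.7), algebra] -/
theorem nsq_add_sub_le (A B C : ι → ℝ) :
    (A + B - C) ⬝ᵥ (A + B - C) ≤ 3 * (A ⬝ᵥ A) + 3 * (B ⬝ᵥ B) + 3 * (C ⬝ᵥ C) := by
  have h1 := dotProduct_self_nonneg' (A - B)
  have h2 := dotProduct_self_nonneg' (A + C)
  have h3 := dotProduct_self_nonneg' (B + C)
  have e : (A + B - C) ⬝ᵥ (A + B - C) + ((A - B) ⬝ᵥ (A - B) + (A + C) ⬝ᵥ (A + C) + (B + C) ⬝ᵥ (B + C))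
      = 3 * (A ⬝ᵥ A) + 3 * (B ⬝ᵥ B) + 3 * (C ⬝ᵥ C) := by
    simp only [add_dotProduct, dotProduct_add, sub_dotProduct, dotProduct_sub, dotProduct_comm B A,
      dotProduct_comm C A, dotProduct_comm C B]
    ring
  linarith

omit [DecidableEq ι] in
/-- **CAUCHY–SCHWARZ OVER A BLOCK**: `|s·Σ_j w_j|² ≤ s·Σ_j|w_j|²` when `s·#{j} ≤ 1`.
[cite: Balaban1983RegularityDecay, p. 590 (4.10), algebra] -/
theorem nsq_smul_sum_le {J : Type*} [Fintype J] {s : ℝ} (hs : 0 ≤ s) (hsN : s * Fintype.card J ≤ 1)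
    (w : J → ι → ℝ) : (s • ∑ j, w j) ⬝ᵥ (s • ∑ j, w j) ≤ s * ∑ j, w j ⬝ᵥ w j := by
  have h := sum_smul_dotProduct_self_le (Finset.univ : Finset J) (q := fun _ => (1 : ℝ))
    (fun _ => zero_le_one) w
  simp only [one_smul, one_mul, Finset.sum_const, Finset.card_univ, nsmul_eq_mul, mul_one] at h
  have h0 : 0 ≤ ∑ j, w j ⬝ᵥ w j := Finset.sum_nonneg fun j _ => dotProduct_self_nonneg' _
  rw [smul_dotProduct, dotProduct_smul, smul_eq_mul, smul_eq_mul]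
  calc s * (s * ((∑ j, w j) ⬝ᵥ ∑ j, w j)) ≤ s * (s * ((Fintype.card J : ℝ) * ∑ j, w j ⬝ᵥ w j)) :=
        mul_le_mul_of_nonneg_left (mul_le_mul_of_nonneg_left h hs) hs
    _ = (s * Fintype.card J) * (s * ∑ j, w j ⬝ᵥ w j) := by ring
    _ ≤ 1 * (s * ∑ j, w j ⬝ᵥ w j) := mul_le_mul_of_nonneg_right hsN (mul_nonneg hs h0)
    _ = s * ∑ j, w j ⬝ᵥ w j := one_mul _

/-- **THE POSITIVELY ORIENTED BONDS ARE AMONG THOSE OF (1.3)**: `(n²/2)·Σ_μ Σ_{u : u+e_μ ∈ Ω} |U(A_μ(u))Φ(u+e_μ) −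
Φ(u)|² ≤ ⟨Φ, (−Δ^{η,N}_{A,Ω})Φ⟩` (the form (1.3) counts every ordered nearest-neighbour pair with weight `n²/2`).
[cite: Balaban1983RegularityDecay, p. 572 (1.3)] -/
theorem bond_sum_le_covLap (F : OrthFlow ι) (κ : ℝ) (n : ℕ) (Ωc : Finset (Fin (d + 1) → ℤ))
    (Ac : (Fin (d + 1) → ℤ) → Fin (d + 1) → ℝ) (Φ : ↥(fineDom n Ωc) × ι → ℝ) :
    (n : ℝ) ^ 2 / 2 * ∑ μ : Fin (d + 1), ∑ u : ↥(fineDom n Ωc),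
        (if u.1 + e1 μ ∈ fineDom n Ωc then gbond F κ Ac Φ μ u.1 else 0)
      ≤ Φ ⬝ᵥ (covLap (regWt n (fineDom n Ωc)) (linkR F κ n Ωc Ac) *ᵥ Φ) := by
  rw [covLap_form]
  set X : ↥(fineDom n Ωc) → ↥(fineDom n Ωc) → ℝ := fun u v => regWt n (fineDom n Ωc) u v *
    ((linkR F κ n Ωc Ac u v *ᵥ fld Φ v - fld Φ u) ⬝ᵥ (linkR F κ n Ωc Ac u v *ᵥ fld Φ v - fld Φ u)) with hX
  have hX0 : ∀ u v, 0 ≤ X u v := fun u v => mul_nonneg (regWt_nonneg n (fineDom n Ωc) u v) (dotProduct_self_nonneg' _)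
  -- per (μ, u): the indicator term is the `v = u + e_μ` slice of `Σ_v X u v`
  have hterm : ∀ μ (u : ↥(fineDom n Ωc)),
      (n : ℝ) ^ 2 / 2 * (if u.1 + e1 μ ∈ fineDom n Ωc then gbond F κ Ac Φ μ u.1 else 0)
      = ∑ v : ↥(fineDom n Ωc), if v.1 = u.1 + e1 μ then X u v else 0 := by
    intro μ u
    rw [sum_subtype_ite_eq]
    by_cases h : u.1 + e1 μ ∈ fineDom n Ωc
    · rw [if_pos h, dif_pos h]
      simp only [hX]
      have hnb : (⟨u.1 + e1 μ, h⟩ : ↥(fineDom n Ωc)).1 ∈ nbrs u.1 := mem_nbrs.2 ⟨μ, Or.inl rfl⟩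
      have hw : regWt n (fineDom n Ωc) u ⟨u.1 + e1 μ, h⟩ = (n : ℝ) ^ 2 / 2 := by
        unfold regWt
        rw [if_pos hnb, mul_one]
      have hl : linkR F κ n Ωc Ac u ⟨u.1 + e1 μ, h⟩ = F.U (κ * Ac u.1 μ) := by
        show F.U (κ * compField Ac u.1 (u.1 + e1 μ)) = F.U (κ * Ac u.1 μ)
        rw [compField_add]
      rw [hw, hl, gbond, ← extR_of_mem Φ ⟨u.1 + e1 μ, h⟩, ← extR_of_mem Φ u]
    · rw [if_neg h, dif_neg h, mul_zero]
  have hlhs : (n : ℝ) ^ 2 / 2 * ∑ μ : Fin (d + 1), ∑ u : ↥(fineDom n Ωc),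
      (if u.1 + e1 μ ∈ fineDom n Ωc then gbond F κ Ac Φ μ u.1 else 0)
      = ∑ u : ↥(fineDom n Ωc), ∑ v : ↥(fineDom n Ωc), ∑ μ : Fin (d + 1), if v.1 = u.1 + e1 μ then X u v else 0 := by
    rw [Finset.mul_sum]
    simp_rw [Finset.mul_sum, hterm]
    rw [Finset.sum_comm]
    exact Finset.sum_congr rfl fun u _ => Finset.sum_comm
  rw [hlhs]
  refine Finset.sum_le_sum fun u _ => Finset.sum_le_sum fun v _ => ?_
  exact sum_dir_ite_le (hX0 u v)

/-! ## §2  The prism inequality per chart point and the per-bond estimate -/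

/-- **PER CHART POINT**: for `x = n·y + j ∈ B(y)`, `x′ = x + n·e_μ ∈ B(y′)`, `y′ = y + e_μ`,
`|U(A(⟨y,y′⟩))U(A(Γ_{y′,x′}))Φ(x′) − U(A(Γ_{y,x}))Φ(x)|² ≤ 2(ℓρ)²|Φ(x′)|² + 2n·Σ_{i<n}|U(A_μ(x+ie_μ))Φ(x+(i+1)e_μ) −
Φ(x+ie_μ)|²` when `|κΛ(y,μ,x)| ≤ ρ`. [cite: Balaban1983RegularityDecay, p. 590 (4.7)–(4.10)] -/
theorem chart_prism_le (F : OrthFlow ι) {ℓ : ℝ}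
    (hLip : ∀ t (v : ι → ℝ), ((F.U t - 1) *ᵥ v) ⬝ᵥ ((F.U t - 1) *ᵥ v) ≤ (ℓ * t) ^ 2 * (v ⬝ᵥ v))
    (κ : ℝ) {n : ℕ} (hn : 1 ≤ n) {Ωc : Finset (Fin (d + 1) → ℤ)} (Ac : (Fin (d + 1) → ℤ) → Fin (d + 1) → ℝ)
    {ρ : ℝ} (Φ : ↥(fineDom n Ωc) × ι → ℝ) (y : ↥Ωc) (μ : Fin (d + 1)) (h : y.1 + e1 μ ∈ Ωc)
    (j : Fin (d + 1) → Fin n) (hΛ : |κ * loopSum Ac n y.1 μ (finePt n y.1 j)| ≤ ρ) :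
    (clink F κ Ac n y.1 μ *ᵥ (F.U (κ * stairSum Ac n (y.1 + e1 μ) (finePt n (y.1 + e1 μ) j)) *ᵥ
          fld Φ (xpt hn (⟨y.1 + e1 μ, h⟩ : ↥Ωc) j))
        - F.U (κ * stairSum Ac n y.1 (finePt n y.1 j)) *ᵥ fld Φ (xpt hn y j)) ⬝ᵥ
      (clink F κ Ac n y.1 μ *ᵥ (F.U (κ * stairSum Ac n (y.1 + e1 μ) (finePt n (y.1 + e1 μ) j)) *ᵥ
          fld Φ (xpt hn (⟨y.1 + e1 μ, h⟩ : ↥Ωc) j))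
        - F.U (κ * stairSum Ac n y.1 (finePt n y.1 j)) *ᵥ fld Φ (xpt hn y j))
      ≤ 2 * (ℓ * ρ) ^ 2 * (fld Φ (xpt hn (⟨y.1 + e1 μ, h⟩ : ↥Ωc) j) ⬝ᵥ fld Φ (xpt hn (⟨y.1 + e1 μ, h⟩ : ↥Ωc) j))
        + 2 * (n * ∑ i ∈ range n, gbond F κ Ac Φ μ (finePt n y.1 j + i • e1 μ)) := by
  set x := finePt n y.1 j with hx
  have hx' : finePt n (y.1 + e1 μ) j = x + n • e1 μ := finePt_add_e1 n y.1 μ j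
  set v : ℕ → ι → ℝ := fun i => extR Φ (x + i • e1 μ) with hv
  set α : ℕ → ℝ := fun i => Ac (x + i • e1 μ) μ with hα
  have hv0 : v 0 = fld Φ (xpt hn y j) := by
    simp only [hv, zero_nsmul, add_zero]
    exact extR_of_mem Φ (xpt hn y j)
  have hvn : v n = fld Φ (xpt hn (⟨y.1 + e1 μ, h⟩ : ↥Ωc) j) := by
    simp only [hv]
    rw [← hx']
    exact extR_of_mem Φ (xpt hn (⟨y.1 + e1 μ, h⟩ : ↥Ωc) j)
  have hsum : ∑ i ∈ range n, α i = segSum Ac μ x n := (segSum_eq_sum Ac μ x n).symm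
  have hP := prism_sq_le F hLip κ (segSum Ac μ (base n y.1) n) (stairSum Ac n (y.1 + e1 μ) (x + n • e1 μ))
    (stairSum Ac n y.1 x) α v n
  rw [hv0, hvn, hsum] at hP
  rw [clink_eq, hx']
  refine hP.trans ?_
  have hhol : (ℓ * (κ * (segSum Ac μ (base n y.1) n + stairSum Ac n (y.1 + e1 μ) (x + n • e1 μ)
      - stairSum Ac n y.1 x - segSum Ac μ x n))) ^ 2 ≤ (ℓ * ρ) ^ 2 := by
    have hL : κ * (segSum Ac μ (base n y.1) n + stairSum Ac n (y.1 + e1 μ) (x + n • e1 μ)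
        - stairSum Ac n y.1 x - segSum Ac μ x n) = κ * loopSum Ac n y.1 μ x := rfl
    rw [hL, mul_pow ℓ, mul_pow ℓ ρ]
    refine mul_le_mul_of_nonneg_left ?_ (sq_nonneg ℓ)
    exact sq_le_sq' (abs_le.1 hΛ).1 (abs_le.1 hΛ).2
  have hkin : ∀ i ∈ range n, (F.U (κ * α i) *ᵥ v (i + 1) - v i) ⬝ᵥ (F.U (κ * α i) *ᵥ v (i + 1) - v i)
      = gbond F κ Ac Φ μ (x + i • e1 μ) := by
    intro i _
    simp only [hα, hv, gbond, succ_nsmul, ← add_assoc]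
  rw [Finset.sum_congr rfl hkin]
  have hP0 : 0 ≤ fld Φ (xpt hn (⟨y.1 + e1 μ, h⟩ : ↥Ωc) j) ⬝ᵥ fld Φ (xpt hn (⟨y.1 + e1 μ, h⟩ : ↥Ωc) j) :=
    dotProduct_self_nonneg' _
  have := mul_le_mul_of_nonneg_right hhol hP0
  linarith

/-- **PER UNIT BOND** `⟨y, y′⟩`, `y′ = y + e_μ`: with `r = ψ − sQΦ`, `|U(A(⟨y,y′⟩))ψ(y′) − ψ(y)|² ≤ 3|r(y′)|² + 3|r(y)|²
+ 3s·(2(ℓρ)²Σ_{x′∈B(y′)}|Φ(x′)|² + 2n²·Σ_{fine μ-bonds b of B(y)∪B(y′), b ⊂ Ω}|D_A Φ(b)|²)`.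
[cite: Balaban1983RegularityDecay, p. 590 (4.7)–(4.10)] -/
theorem bond_term_le (F : OrthFlow ι) {ℓ : ℝ}
    (hLip : ∀ t (v : ι → ℝ), ((F.U t - 1) *ᵥ v) ⬝ᵥ ((F.U t - 1) *ᵥ v) ≤ (ℓ * t) ^ 2 * (v ⬝ᵥ v))
    (κ : ℝ) {n : ℕ} (hn : 1 ≤ n) {Ωc : Finset (Fin (d + 1) → ℤ)} (Ac : (Fin (d + 1) → ℤ) → Fin (d + 1) → ℝ)
    {ρ : ℝ} (Φ : ↥(fineDom n Ωc) × ι → ℝ) (ψ : ↥Ωc × ι → ℝ) (y : ↥Ωc) (μ : Fin (d + 1))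
    (h : y.1 + e1 μ ∈ Ωc) (hΛ : ∀ x, blk n x = y.1 → |κ * loopSum Ac n y.1 μ x| ≤ ρ) :
    (clink F κ Ac n y.1 μ *ᵥ fld ψ ⟨y.1 + e1 μ, h⟩ - fld ψ y) ⬝ᵥ
        (clink F κ Ac n y.1 μ *ᵥ fld ψ ⟨y.1 + e1 μ, h⟩ - fld ψ y)
      ≤ 3 * (fld (ψ - ((n : ℝ) ^ (d + 1))⁻¹ • (avgOp (rBlkWt n Ωc (fineDom n Ωc)) (transR F κ hn Ωc Ac) *ᵥ Φ))
              ⟨y.1 + e1 μ, h⟩ ⬝ᵥ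
            fld (ψ - ((n : ℝ) ^ (d + 1))⁻¹ • (avgOp (rBlkWt n Ωc (fineDom n Ωc)) (transR F κ hn Ωc Ac) *ᵥ Φ))
              ⟨y.1 + e1 μ, h⟩)
        + 3 * (fld (ψ - ((n : ℝ) ^ (d + 1))⁻¹ • (avgOp (rBlkWt n Ωc (fineDom n Ωc)) (transR F κ hn Ωc Ac) *ᵥ Φ))
              y ⬝ᵥ
            fld (ψ - ((n : ℝ) ^ (d + 1))⁻¹ • (avgOp (rBlkWt n Ωc (fineDom n Ωc)) (transR F κ hn Ωc Ac) *ᵥ Φ)) y)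
        + 3 * (((n : ℝ) ^ (d + 1))⁻¹ *
            (2 * (ℓ * ρ) ^ 2 * ∑ j : Fin (d + 1) → Fin n,
                fld Φ (xpt hn (⟨y.1 + e1 μ, h⟩ : ↥Ωc) j) ⬝ᵥ fld Φ (xpt hn (⟨y.1 + e1 μ, h⟩ : ↥Ωc) j)
              + 2 * (n : ℝ) ^ 2 * ∑ u : ↥(fineDom n Ωc),
                (if u.1 + e1 μ ∈ fineDom n Ωc ∧ (blk n u.1 = y.1 ∨ blk n u.1 = y.1 + e1 μ)
                  then gbond F κ Ac Φ μ u.1 else 0))) := by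
  set s : ℝ := ((n : ℝ) ^ (d + 1))⁻¹ with hs_def
  set Q := avgOp (rBlkWt n Ωc (fineDom n Ωc)) (transR F κ hn Ωc Ac) with hQ
  set y' : ↥Ωc := ⟨y.1 + e1 μ, h⟩ with hy'
  set r := ψ - s • (Q *ᵥ Φ) with hr
  set C := clink F κ Ac n y.1 μ with hC
  have hn0 : (0 : ℝ) < n := by exact_mod_cast hn
  have hs : 0 ≤ s := by positivity
  have hsN : s * Fintype.card (Fin (d + 1) → Fin n) ≤ 1 := by
    rw [Fintype.card_fun, Fintype.card_fin, Fintype.card_fin]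
    push_cast
    rw [hs_def, inv_mul_cancel₀ (by positivity)]
  -- decomposition ψ = r + sQΦ
  have hfld : ∀ z : ↥Ωc, fld ψ z = fld r z + s • fld (Q *ᵥ Φ) z := by
    intro z
    funext i
    simp [hr]
  have hdec : C *ᵥ fld ψ y' - fld ψ y
      = C *ᵥ fld r y' + (C *ᵥ (s • fld (Q *ᵥ Φ) y') - s • fld (Q *ᵥ Φ) y) - fld r y := by
    rw [hfld y', hfld y, Matrix.mulVec_add]
    abel
  rw [hdec]
  refine (nsq_add_sub_le _ _ _).trans ?_
  rw [orth_dotProduct_mulVec_self (clink_orth F κ Ac n y.1 μ)]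
  -- the middle term
  have hMid : (C *ᵥ (s • fld (Q *ᵥ Φ) y') - s • fld (Q *ᵥ Φ) y) ⬝ᵥ (C *ᵥ (s • fld (Q *ᵥ Φ) y') - s • fld (Q *ᵥ Φ) y)
      ≤ s * (2 * (ℓ * ρ) ^ 2 * ∑ j : Fin (d + 1) → Fin n, fld Φ (xpt hn y' j) ⬝ᵥ fld Φ (xpt hn y' j)
          + 2 * (n : ℝ) ^ 2 * ∑ u : ↥(fineDom n Ωc),
            (if u.1 + e1 μ ∈ fineDom n Ωc ∧ (blk n u.1 = y.1 ∨ blk n u.1 = y.1 + e1 μ) then gbond F κ Ac Φ μ u.1 else 0)) := by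
    set w : (Fin (d + 1) → Fin n) → ι → ℝ := fun j =>
      C *ᵥ (F.U (κ * stairSum Ac n y'.1 (finePt n y'.1 j)) *ᵥ fld Φ (xpt hn y' j))
        - F.U (κ * stairSum Ac n y.1 (finePt n y.1 j)) *ᵥ fld Φ (xpt hn y j) with hw
    have hMid_eq : C *ᵥ (s • fld (Q *ᵥ Φ) y') - s • fld (Q *ᵥ Φ) y = s • ∑ j, w j := by
      rw [hQ, fld_avgOp_chart, fld_avgOp_chart, Matrix.mulVec_smul, ← smul_sub, Matrix.mulVec_sum,
        ← Finset.sum_sub_distrib]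
    rw [hMid_eq]
    refine (nsq_smul_sum_le hs hsN w).trans (mul_le_mul_of_nonneg_left ?_ hs)
    -- Σ_j |w_j|² ≤ …
    have hwj : ∀ j, w j ⬝ᵥ w j ≤ 2 * (ℓ * ρ) ^ 2 * (fld Φ (xpt hn y' j) ⬝ᵥ fld Φ (xpt hn y' j))
        + 2 * (n * ∑ i ∈ range n, gbond F κ Ac Φ μ (finePt n y.1 j + i • e1 μ)) := fun j =>
      chart_prism_le F hLip κ hn Ac Φ y μ h j (hΛ _ (blk_finePt hn y.1 j))
    refine (Finset.sum_le_sum fun j _ => hwj j).trans ?_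
    rw [Finset.sum_add_distrib, ← Finset.mul_sum, ← Finset.mul_sum, ← Finset.mul_sum, Finset.sum_comm]
    have hi : ∀ i ∈ range n, ∑ j : Fin (d + 1) → Fin n, gbond F κ Ac Φ μ (finePt n y.1 j + i • e1 μ)
        ≤ ∑ u : ↥(fineDom n Ωc), (if u.1 + e1 μ ∈ fineDom n Ωc ∧ (blk n u.1 = y.1 ∨ blk n u.1 = y.1 + e1 μ)
            then gbond F κ Ac Φ μ u.1 else 0) := fun i hi =>
      chart_shift_sum_le hn y.2 h (gbond_nonneg F κ Ac Φ μ) (Finset.mem_range.1 hi)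
    have hsumi := Finset.sum_le_sum hi
    rw [Finset.sum_const, Finset.card_range, nsmul_eq_mul] at hsumi
    have h2n : (0 : ℝ) ≤ 2 * n := by positivity
    have := mul_le_mul_of_nonneg_left hsumi h2n
    nlinarith [this]
  linarith [hMid]

/-! ## §3  THE COVARIANT AVERAGING INEQUALITY -/

/-- **THE COVARIANT AVERAGING INEQUALITY** (the bond part of (1.22) through the block averages, cf. (4.7)–(4.10)): for
every fine field `Φ` on `Ω`, every `ψ` on `Ω^{(k)}`, and `ρ` with `|κΛ(y,μ,x)| ≤ ρ` for all prisms of `Ω`,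
`Σ_{⟨y,y′⟩⊂Ω^{(k)}} |U(A(⟨y,y′⟩))ψ(y′) − ψ(y)|² ≤ 6(d+1)|ψ − sQΦ|² + 6(d+1)(ℓρ)²·s|Φ|² + 24·s·⟨Φ,(−Δ^{η,N}_{A,Ω})Φ⟩`,
`s = η^{d+1}`. [cite: Balaban1983RegularityDecay, p. 574 (1.22) with p. 590 (4.7)–(4.10)] -/
theorem covDiffSq_le (F : OrthFlow ι) {ℓ : ℝ}
    (hLip : ∀ t (v : ι → ℝ), ((F.U t - 1) *ᵥ v) ⬝ᵥ ((F.U t - 1) *ᵥ v) ≤ (ℓ * t) ^ 2 * (v ⬝ᵥ v))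
    (κ : ℝ) {n : ℕ} (hn : 1 ≤ n) (Ωc : Finset (Fin (d + 1) → ℤ)) (Ac : (Fin (d + 1) → ℤ) → Fin (d + 1) → ℝ)
    {ρ : ℝ} (hΛ : ∀ y ∈ Ωc, ∀ μ : Fin (d + 1), y + e1 μ ∈ Ωc → ∀ x, blk n x = y → |κ * loopSum Ac n y μ x| ≤ ρ)
    (Φ : ↥(fineDom n Ωc) × ι → ℝ) (ψ : ↥Ωc × ι → ℝ) :
    covDiffSq F κ Ac n Ωc ψ
      ≤ 6 * (d + 1) * ((ψ - ((n : ℝ) ^ (d + 1))⁻¹ •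
              (avgOp (rBlkWt n Ωc (fineDom n Ωc)) (transR F κ hn Ωc Ac) *ᵥ Φ)) ⬝ᵥ
            (ψ - ((n : ℝ) ^ (d + 1))⁻¹ • (avgOp (rBlkWt n Ωc (fineDom n Ωc)) (transR F κ hn Ωc Ac) *ᵥ Φ)))
        + 6 * (d + 1) * (ℓ * ρ) ^ 2 * (((n : ℝ) ^ (d + 1))⁻¹ * (Φ ⬝ᵥ Φ))
        + 24 * (((n : ℝ) ^ (d + 1))⁻¹ * (Φ ⬝ᵥ (covLap (regWt n (fineDom n Ωc)) (linkR F κ n Ωc Ac) *ᵥ Φ))) := by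
  set Rr : ↥Ωc → ℝ := fun z =>
    fld (ψ - ((n : ℝ) ^ (d + 1))⁻¹ • (avgOp (rBlkWt n Ωc (fineDom n Ωc)) (transR F κ hn Ωc Ac) *ᵥ Φ)) z ⬝ᵥ
      fld (ψ - ((n : ℝ) ^ (d + 1))⁻¹ • (avgOp (rBlkWt n Ωc (fineDom n Ωc)) (transR F κ hn Ωc Ac) *ᵥ Φ)) z
    with hRr
  set S : ↥Ωc → ℝ := fun z => ∑ j : Fin (d + 1) → Fin n, fld Φ (xpt hn z j) ⬝ᵥ fld Φ (xpt hn z j) with hS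
  set G : ↥Ωc → Fin (d + 1) → ℝ := fun y μ => ∑ u : ↥(fineDom n Ωc),
    (if u.1 + e1 μ ∈ fineDom n Ωc ∧ (blk n u.1 = y.1 ∨ blk n u.1 = y.1 + e1 μ) then gbond F κ Ac Φ μ u.1 else 0)
    with hG
  have hn0 : (0 : ℝ) < n := by exact_mod_cast hn
  have hs : (0 : ℝ) ≤ ((n : ℝ) ^ (d + 1))⁻¹ := by positivity
  have hRr0 : ∀ z, 0 ≤ Rr z := fun z => dotProduct_self_nonneg' _
  have hS0 : ∀ z, 0 ≤ S z := fun z => Finset.sum_nonneg fun j _ => dotProduct_self_nonneg' _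
  -- per-term bound (including the absent bonds)
  have hterm : ∀ (y : ↥Ωc) (μ : Fin (d + 1)),
      (if h : y.1 + e1 μ ∈ Ωc then
          (clink F κ Ac n y.1 μ *ᵥ fld ψ ⟨y.1 + e1 μ, h⟩ - fld ψ y) ⬝ᵥ
            (clink F κ Ac n y.1 μ *ᵥ fld ψ ⟨y.1 + e1 μ, h⟩ - fld ψ y) else 0)
        ≤ 3 * (if h : y.1 + e1 μ ∈ Ωc then Rr ⟨y.1 + e1 μ, h⟩ else 0) + 3 * Rr y
          + (6 * ((n : ℝ) ^ (d + 1))⁻¹ * (ℓ * ρ) ^ 2) * (if h : y.1 + e1 μ ∈ Ωc then S ⟨y.1 + e1 μ, h⟩ else 0)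
          + (6 * ((n : ℝ) ^ (d + 1))⁻¹ * (n : ℝ) ^ 2) * (if y.1 + e1 μ ∈ Ωc then G y μ else 0) := by
    intro y μ
    by_cases h : y.1 + e1 μ ∈ Ωc
    · rw [dif_pos h, dif_pos h, dif_pos h, if_pos h]
      have hb := bond_term_le F hLip κ hn Ac Φ ψ y μ h (hΛ y.1 y.2 μ h)
      simp only [hRr, hS, hG]
      linarith [hb]
    · rw [dif_neg h, dif_neg h, dif_neg h, if_neg h]
      have := hRr0 y
      linarith
  have hE : covDiffSq F κ Ac n Ωc ψ ≤ ∑ y : ↥Ωc, ∑ μ : Fin (d + 1),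
      (3 * (if h : y.1 + e1 μ ∈ Ωc then Rr ⟨y.1 + e1 μ, h⟩ else 0) + 3 * Rr y
        + (6 * ((n : ℝ) ^ (d + 1))⁻¹ * (ℓ * ρ) ^ 2) * (if h : y.1 + e1 μ ∈ Ωc then S ⟨y.1 + e1 μ, h⟩ else 0)
        + (6 * ((n : ℝ) ^ (d + 1))⁻¹ * (n : ℝ) ^ 2) * (if y.1 + e1 μ ∈ Ωc then G y μ else 0)) :=
    Finset.sum_le_sum fun y _ => Finset.sum_le_sum fun μ _ => hterm y μ
  -- the four sums
  have h1 : ∑ y : ↥Ωc, ∑ μ : Fin (d + 1), (if h : y.1 + e1 μ ∈ Ωc then Rr ⟨y.1 + e1 μ, h⟩ else 0)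
      ≤ (d + 1) * ((ψ - ((n : ℝ) ^ (d + 1))⁻¹ • (avgOp (rBlkWt n Ωc (fineDom n Ωc)) (transR F κ hn Ωc Ac) *ᵥ Φ)) ⬝ᵥ
          (ψ - ((n : ℝ) ^ (d + 1))⁻¹ • (avgOp (rBlkWt n Ωc (fineDom n Ωc)) (transR F κ hn Ωc Ac) *ᵥ Φ))) := by
    rw [Finset.sum_comm]
    calc ∑ μ : Fin (d + 1), ∑ y : ↥Ωc, (if h : y.1 + e1 μ ∈ Ωc then Rr ⟨y.1 + e1 μ, h⟩ else 0)
        ≤ ∑ μ : Fin (d + 1), ∑ y : ↥Ωc, Rr y := Finset.sum_le_sum fun μ _ => sum_shift_le hRr0 μ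
      _ = (d + 1) * ((ψ - ((n : ℝ) ^ (d + 1))⁻¹ • (avgOp (rBlkWt n Ωc (fineDom n Ωc)) (transR F κ hn Ωc Ac) *ᵥ Φ)) ⬝ᵥ
          (ψ - ((n : ℝ) ^ (d + 1))⁻¹ • (avgOp (rBlkWt n Ωc (fineDom n Ωc)) (transR F κ hn Ωc Ac) *ᵥ Φ))) := by
          rw [Finset.sum_const, Finset.card_univ, Fintype.card_fin, nsmul_eq_mul, dotProduct_eq_sum_fld]
          push_cast
          rfl
  have h2 : ∑ y : ↥Ωc, ∑ μ : Fin (d + 1), Rr y = (d + 1) * ((ψ - ((n : ℝ) ^ (d + 1))⁻¹ • (avgOp (rBlkWt n Ωc (fineDom n Ωc)) (transR F κ hn Ωc Ac) *ᵥ Φ)) ⬝ᵥ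
          (ψ - ((n : ℝ) ^ (d + 1))⁻¹ • (avgOp (rBlkWt n Ωc (fineDom n Ωc)) (transR F κ hn Ωc Ac) *ᵥ Φ))) := by
    simp only [Finset.sum_const, Finset.card_univ, Fintype.card_fin, nsmul_eq_mul]
    rw [← Finset.mul_sum, dotProduct_eq_sum_fld]
    push_cast
    rfl
  have h3 : ∑ y : ↥Ωc, ∑ μ : Fin (d + 1), (if h : y.1 + e1 μ ∈ Ωc then S ⟨y.1 + e1 μ, h⟩ else 0)
      ≤ (d + 1) * (Φ ⬝ᵥ Φ) := by
    rw [Finset.sum_comm]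
    calc ∑ μ : Fin (d + 1), ∑ y : ↥Ωc, (if h : y.1 + e1 μ ∈ Ωc then S ⟨y.1 + e1 μ, h⟩ else 0)
        ≤ ∑ μ : Fin (d + 1), ∑ y : ↥Ωc, S y := Finset.sum_le_sum fun μ _ => sum_shift_le hS0 μ
      _ = (d + 1) * (Φ ⬝ᵥ Φ) := by
          rw [Finset.sum_const, Finset.card_univ, Fintype.card_fin, nsmul_eq_mul,
            dotProduct_self_eq_sum_blocks hn Ωc Φ]
          push_cast
          rfl
  have h4 : (n : ℝ) ^ 2 * ∑ y : ↥Ωc, ∑ μ : Fin (d + 1), (if y.1 + e1 μ ∈ Ωc then G y μ else 0)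
      ≤ 4 * (Φ ⬝ᵥ (covLap (regWt n (fineDom n Ωc)) (linkR F κ n Ωc Ac) *ᵥ Φ)) := by
    have hd := double_count_le n Ωc (g := fun μ z => gbond F κ Ac Φ μ z) (fun μ z => gbond_nonneg F κ Ac Φ μ z)
    have hc := bond_sum_le_covLap F κ n Ωc Ac Φ
    have hn2 : (0 : ℝ) ≤ (n : ℝ) ^ 2 := by positivity
    have := mul_le_mul_of_nonneg_left hd hn2
    simp only [hG]
    linarith
  have hsum : ∑ y : ↥Ωc, ∑ μ : Fin (d + 1),
      (3 * (if h : y.1 + e1 μ ∈ Ωc then Rr ⟨y.1 + e1 μ, h⟩ else 0) + 3 * Rr y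
        + (6 * ((n : ℝ) ^ (d + 1))⁻¹ * (ℓ * ρ) ^ 2) * (if h : y.1 + e1 μ ∈ Ωc then S ⟨y.1 + e1 μ, h⟩ else 0)
        + (6 * ((n : ℝ) ^ (d + 1))⁻¹ * (n : ℝ) ^ 2) * (if y.1 + e1 μ ∈ Ωc then G y μ else 0))
      = 3 * ∑ y : ↥Ωc, ∑ μ : Fin (d + 1), (if h : y.1 + e1 μ ∈ Ωc then Rr ⟨y.1 + e1 μ, h⟩ else 0)
        + 3 * ∑ y : ↥Ωc, ∑ μ : Fin (d + 1), Rr y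
        + (6 * ((n : ℝ) ^ (d + 1))⁻¹ * (ℓ * ρ) ^ 2) * ∑ y : ↥Ωc, ∑ μ : Fin (d + 1),
            (if h : y.1 + e1 μ ∈ Ωc then S ⟨y.1 + e1 μ, h⟩ else 0)
        + (6 * ((n : ℝ) ^ (d + 1))⁻¹ * (n : ℝ) ^ 2) *
            ∑ y : ↥Ωc, ∑ μ : Fin (d + 1), (if y.1 + e1 μ ∈ Ωc then G y μ else 0) := by
    simp only [Finset.sum_add_distrib, Finset.mul_sum]
  rw [hsum, h2] at hE
  have hρ2 : 0 ≤ 6 * ((n : ℝ) ^ (d + 1))⁻¹ * (ℓ * ρ) ^ 2 := by positivity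
  have h6s : 0 ≤ 6 * ((n : ℝ) ^ (d + 1))⁻¹ := by positivity
  have e4 : (6 * ((n : ℝ) ^ (d + 1))⁻¹ * (n : ℝ) ^ 2) *
      ∑ y : ↥Ωc, ∑ μ : Fin (d + 1), (if y.1 + e1 μ ∈ Ωc then G y μ else 0)
      = 6 * ((n : ℝ) ^ (d + 1))⁻¹ *
        ((n : ℝ) ^ 2 * ∑ y : ↥Ωc, ∑ μ : Fin (d + 1), (if y.1 + e1 μ ∈ Ωc then G y μ else 0)) := by
    ring
  rw [e4] at hE
  have hb1 := mul_le_mul_of_nonneg_left h1 (by norm_num : (0 : ℝ) ≤ 3)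
  have hb3 := mul_le_mul_of_nonneg_left h3 hρ2
  have hb4 := mul_le_mul_of_nonneg_left h4 h6s
  linarith [hE, hb1, hb3, hb4]

end

end Literature.MathematicalPhysics.QuantumFieldTheory.Balaban1983to89.B4Prop31Averaging
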